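/-
Copyright (c) 2026 the pub-hodgecm-mathlib formalisation cell (harness21).  Prover seat hodgecm-mathlib-F0P3a-p01 (g32), req620 Track A «(D-RAM) FOUR-FRAME» squad, unit U2H:
the (ρ2b′-X) child `stub_U2H_fixedPointCensus_typeTwo_unit0` (U2H ED. 15 :418) — organ O-Lit of LH4-p14 (g3)'s RHO2BX-ORDER v1 (payer of record; this seat co-hand, dealer
LH4-plan (g12) WORD #6 (2) ∕ #8 (2)): the 2-FREE κ-sign of the opposite literal.  2026-09-04.
-/
import Literature.NumberTheory.Rogawski1990.TypeTwoRamifiedOppositeLiteral     -- ★ p847834 (F0P3a-p03, tame): `finKappaAt_eq_ite_of_onePlace_eigenvector` (★ p847566), `exists_norm_mul_nonNorm_iff`, `isUnit_eval_finCharpolyTwo_of_not_exists_isRoot`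
import Literature.NumberTheory.LocalFields.QuadraticLocalNormDichotomy         -- ★ (J3′) `IsCMField.exists_fixed_nonnorm_dichotomy'` — the σ_w-norm dichotomy at EVERY non-split place, no `|2| = 1`
import HarnessLib

/-!
# Crux `H413`, line LH4 «(D-RAM) FOUR-FRAME» road — unit U2H, (ρ2b′-X): organ O-Lit, first brick — THE κ-SIGN OF THE OPPOSITE LITERAL IS 2-FREE

Cell `hodgecm-mathlib` (D-0151), FLOOR 0, crux item H413 = `stmt-HodgeConjecture-24833`, route of record `HCCMUnconditional`; squad F0∕P3c∕LH4; registered stub served: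
`F0P3cDyRamFourFrameU2H.stub_U2H_fixedPointCensus_typeTwo_unit0` ((ρ2b′-X), U2H ED. 15 :418) through LH4-p14 (g3)'s layers ★ p857061 ∕ ★ p857086 ∕ ★ p857104 — the one socket left
is (ρ2b′-XLit): ONE signed pair of matches `(t₀, t₁)` per deep type-(2) `γ_H` carrying the census law.  THEOREMS ONLY (no `def`, no instance, no notation, no `sorry`); lane
`--supports stmt-HodgeConjecture-24833 --as helper` (count-neutral).
WHAT THIS FILE DOES.  The literals lineage proved at TAME ramified places (`2 ∈ 𝒪_w^×`): the frame literal `t₀` has `κ_v(γ_H, t₀) = (y_λ, θ)_v` (★ `exists_vDeep_frameLiteral_ram`,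
ALREADY 2-free) and the opposite literal `t₁` — any match with a `u_w`-eigenvector of `H′_w`-length `(−det H′_w)·η`, `η` a σ_w-fixed NON-NORM — has `κ_v(γ_H, t₁) = −(y_λ, θ)_v`
(★ `finKappaAt_eq_neg_hilbertSymbol_of_nonNorm_length`, which takes `|2|_w = 1` and `e(w|v) ≠ 1` ONLY to feed the tame norm dichotomy ★ `norm_dichotomy_of_not_norm`).  At the WILD
places of the (D-RAM) road the dichotomy is ★ (J3′) `IsCMField.exists_fixed_nonnorm_dichotomy'` (index two of `N(L_w^×)` in the σ_w-fixed line at every non-split place, local class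
field theory as typed by the LocalFields lineage), so:
* §1 `norm_dichotomy_of_not_norm_anyPlace` — for EVERY σ_w-fixed non-norm `ε` at any `w` fixed by complex conjugation: every non-zero σ_w-fixed `s` is `z·σ_w z` or `ε·(z·σ_w z)`
  (the tame lemma's conclusion VERBATIM, hypotheses `he`, `h2` DROPPED);
* §2 `finKappaAt_eq_neg_hilbertSymbol_of_nonNorm_length_anyPlace` — the tame κ-sign lemma with `he`, `h2v`, `hvη` DROPPED (proof verbatim over §1; `η ≠ 0` because `0` is a norm).
So O-Lit's sign bookkeeping is settled at wild places: whatever anisotropic block the payer chooses for `t₁` (T3, LH4-p12 (g4): the partner plane `h·n₀` ⊕ the line `⟨a₀⟩`, `a₀` a σ-fixed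
non-norm UNIT — ★ `WildQuadraticDatumNonNormUnitLevel`), its κ is `−(y_λ, θ)_v` by §2 the moment its `u_w`-eigenvector has length `(−det H′_w)·a₀`.
HONEST LABEL.  Count-neutral helper; (ρ2b′-X) stays an OPEN prover target until the organs of RHO2BX-ORDER v1 land; `HC_CM` is proved only modulo the 7 printed citations (2 remaining
named inputs: hLiu418 = `stmt-HodgeConjecture-24832`, h413 = `stmt-HodgeConjecture-24833`) until rung 0 closes.

## References
* [Rogawski1990] J. D. Rogawski, *Automorphic Representations of Unitary Groups in Three Variables*, Ann. of Math. Stud. 123 (1990), §3.6 pp. 28–29, §4.3 (4.3.2) p. 43, §4.9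
  Prop. 4.9.1 p. 55.
* [LabesseLanglands1979] J.-P. Labesse, R. P. Langlands, *L-indistinguishability for SL(2)*, Canad. J. Math. 31 (1979), §2 pp. 8–10.
* [LanglandsShelstad1987] R. P. Langlands, D. Shelstad, *On the definition of transfer factors*, Math. Ann. 278 (1987), §1.
* [NeukirchANT1999] J. Neukirch, *Algebraic Number Theory*, Springer GMW 322 (1999), Ch. V §1 Thm. (1.1) (local norm index of a quadratic extension is 2).
-/

set_option autoImplicit false

noncomputable section

open NumberField IsDedekindDomain Matrix Polynomial
open Literature.NumberTheory.Automorphic Literature.NumberTheory.Automorphic.UnitaryGroup Literature.NumberTheory.Automorphic.UnitaryLatticeTree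
open Literature.NumberTheory.GaloisRepresentations Literature.NumberTheory.QuadraticForms Literature.NumberTheory.Rogawski1990
open scoped MatrixGroups ValuativeRel

namespace Summit.HodgeConjecture.HodgeConjecture.Cruxes.H413.F0P3cDyRamTypeTwoLiteralSignWild

section CM

variable (L : Type) [Field L] [NumberField L] [IsCMField L] (H' : Matrix (Fin 3) (Fin 3) L) {v : HeightOneSpectrum (𝓞 ↥(maximalRealSubfield L))}
  (w : PlacesOver L v) (hw : IsCMField.complexConj L • w.1 = w.1)

/-! ## §1 The norm dichotomy for every non-norm, at every non-split place -/

/-- **THE NORM DICHOTOMY HOLDS FOR EVERY NON-NORM `ε`, AT EVERY PLACE FIXED BY COMPLEX CONJUGATION** (2-free twin of ★ `norm_dichotomy_of_not_norm`): from ★ (J3′)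
`IsCMField.exists_fixed_nonnorm_dichotomy'` (some σ_w-fixed `ε₀ ∉ N` with `fixed line = N ∪ ε₀·N`) and `ε ∉ N`, `σ_w ε = ε`: every non-zero σ_w-fixed `s` is `z·σ_w z` or
`ε·(z·σ_w z)` with `z ≠ 0`. [cite: NeukirchANT1999, Ch. V §1 Thm. (1.1)] [cite: LabesseLanglands1979, §2 pp. 8–9] [cite: Rogawski1990, §3.6 pp. 28–29] -/
theorem norm_dichotomy_of_not_norm_anyPlace {ε : w.1.adicCompletion L}
    (hσε : galAdicCompletionMap (L := L) (IsCMField.complexConj L) hw ε = ε)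
    (hεN : ¬ ∃ s : w.1.adicCompletion L, s * galAdicCompletionMap (L := L) (IsCMField.complexConj L) hw s = ε) :
    ∀ s : w.1.adicCompletion L, s ≠ 0 → galAdicCompletionMap (L := L) (IsCMField.complexConj L) hw s = s →
      ∃ z : w.1.adicCompletion L, z ≠ 0 ∧
        (s = z * galAdicCompletionMap (L := L) (IsCMField.complexConj L) hw z ∨
          s = ε * (z * galAdicCompletionMap (L := L) (IsCMField.complexConj L) hw z)) := by
  set σ := galAdicCompletionMap (L := L) (IsCMField.complexConj L) hw
  obtain ⟨ε₀, -, -, -, hdich₀⟩ := Literature.NumberTheory.LocalFields.IsCMField.exists_fixed_nonnorm_dichotomy' L w hw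
  -- (J3′) is typed over `SemiLocal.Place`; re-read it in the `PlacesOver` ∕ `w.1` currency of the literals files (definitionally equal)
  have hdich : ∀ s : w.1.adicCompletion L, s ≠ 0 → σ s = s →
      ∃ z : w.1.adicCompletion L, z ≠ 0 ∧ (s = z * σ z ∨ s = (show w.1.adicCompletion L from ε₀) * (z * σ z)) := hdich₀
  have hε0 : ε ≠ 0 := fun h => hεN ⟨0, by rw [h, zero_mul]⟩
  -- `ε = ε₀ N(z₁)` (the other branch would make `ε` a norm)
  obtain ⟨z₁, hz₁0, hε | hε⟩ := hdich ε hε0 hσε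
  · exact absurd ⟨z₁, hε.symm⟩ hεN
  intro s hs0 hσs
  obtain ⟨z, hz0, h | h⟩ := hdich s hs0 hσs
  · exact ⟨z, hz0, Or.inl h⟩
  · -- `s = ε₀ N(z) = ε N(z ∕ z₁)`
    have hN1 : z₁ * σ z₁ ≠ 0 := mul_ne_zero hz₁0 ((map_ne_zero σ).2 hz₁0)
    refine ⟨z / z₁, div_ne_zero hz0 hz₁0, Or.inr ?_⟩
    rw [map_div₀, div_mul_div_comm, hε, h, mul_assoc, mul_div_assoc', mul_comm (z₁ * σ z₁), mul_div_assoc, div_self hN1, mul_one]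

/-! ## §2 The κ-sign of the opposite literal, 2-free -/

include hw in
/-- **THE κ-SIGN FROM AN EIGENVECTOR OF NON-NORM FRAME LENGTH, AT ANY NON-SPLIT PLACE** (2-free twin of ★ `finKappaAt_eq_neg_hilbertSymbol_of_nonNorm_length`: hypotheses
`e(w|v) ≠ 1`, `|2|_w = 1`, `|η|_w = 1` dropped).  If `t₁` matches `γ_H` (`χ_{g_w}` rootless) and `(t₁)_w` has a `u_w`-eigenvector `q₁` of `H′_w`-length `(−det H′_w)·η` with `η`
σ_w-fixed and NOT a norm, then `κ_v(γ_H, t₁) = −(y_λ, θ)_v` for `ι_w y_λ = −det H′_w`.  (★ `finKappaAt_eq_ite_of_onePlace_eigenvector`, index two ★ `exists_norm_mul_nonNorm_iff` over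
§1, ★ `hilbertSymbol_eq_one_iff_exists_norm_toPlace`.) [cite: Rogawski1990, §4.9 Prop. 4.9.1 p. 55; §4.3 (4.3.2) p. 43] [cite: LanglandsShelstad1987, §1] -/
theorem finKappaAt_eq_neg_hilbertSymbol_of_nonNorm_length_anyPlace (hH' : (H'.map (cmConjRingHom L)).transpose = H')
    (hH'w : IsUnit (placeForm H' w.1))
    (yl : v.adicCompletion ↥(maximalRealSubfield L)) (hyl : toPlace v w yl = -(placeForm H' w.1).det)
    (γH : (cmDatum L 2 (Matrix.of fun i j : Fin 2 => if i.val + j.val + 1 = 2 then (1 : L) else 0)).Local v ×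
      (cmDatum L 1 (Matrix.of fun i j : Fin 1 => if i.val + j.val + 1 = 1 then (1 : L) else 0)).Local v)
    (hirr : ¬ ∃ x : w.1.adicCompletion L, (((γH.1.val : GL (Fin 2) (UnitaryGroup.LocalRing L v)).val.map
        (Pi.evalRingHom (fun w' : PlacesOver L v => w'.1.adicCompletion L) w)).charpoly).IsRoot x)
    {t₁ : (cmDatum L 3 H').Local v} (ht₁ : IsLocalNormPair L H' v γH t₁)
    {q₁ : Fin 3 → w.1.adicCompletion L}
    (hq₁ : (((localNonsplitEquiv (IsCMField.complexConj L) H' (IsCMField.complexConj_ne_one L) w hw t₁).val :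
        GL (Fin 3) (w.1.adicCompletion L)) : Matrix (Fin 3) (Fin 3) (w.1.adicCompletion L)) *ᵥ q₁ = finGammaTwo L v γH w • q₁)
    (hq₁0 : q₁ ≠ 0) {η : w.1.adicCompletion L}
    (hlen₁ : (∑ i : Fin 3, ∑ k : Fin 3, galAdicCompletionMap (L := L) (IsCMField.complexConj L) hw (q₁ i) * placeForm H' w.1 i k * q₁ k) = (-(placeForm H' w.1).det) * η)
    (hση : galAdicCompletionMap (L := L) (IsCMField.complexConj L) hw η = η)
    (hηN : ¬ ∃ t : w.1.adicCompletion L, t * galAdicCompletionMap (L := L) (IsCMField.complexConj L) hw t = η) :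
    finKappaAt L v H' γH t₁ = -hilbertSymbol (v.adicCompletion ↥(maximalRealSubfield L)) yl
        (algebraMap ↥(maximalRealSubfield L) _ ((cmQuadraticGenerator L : 𝓞 ↥(maximalRealSubfield L)) : ↥(maximalRealSubfield L))) := by
  haveI : Algebra.IsQuadraticExtension ↥(maximalRealSubfield L) L := IsCMField.isQuadraticExtension L
  have hχ : IsUnit ((finCharpolyTwo L v γH).eval (finGammaTwo L v γH)) := isUnit_eval_finCharpolyTwo_of_not_exists_isRoot L w hw γH hirr
  have hdet0 : -(placeForm H' w.1).det ≠ 0 := (((Matrix.isUnit_iff_isUnit_det _).1 hH'w).neg).ne_zero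
  have hη0 : η ≠ 0 := fun h0 => hηN ⟨0, by rw [h0, zero_mul]⟩
  have hlen0 : (∑ i : Fin 3, ∑ k : Fin 3, (galAdicCompletionMap (L := L) (IsCMField.complexConj L) hw) (q₁ i) * placeForm H' w.1 i k * q₁ k) ≠ 0 := by
    rw [hlen₁]; exact mul_ne_zero hdet0 hη0
  rw [finKappaAt_eq_ite_of_onePlace_eigenvector L H' w hw γH hχ ht₁ hq₁ hq₁0 hlen0, hlen₁]
  -- index two: `(−det H′_w)·η ∈ N ⟺ −det H′_w ∉ N`, and `[−det H′_w ∈ N] = (y_λ, θ)_v`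
  have hσdet : (galAdicCompletionMap (L := L) (IsCMField.complexConj L) hw) (-(placeForm H' w.1).det) = -(placeForm H' w.1).det := by
    have hh := placeForm_hermitian_of_smul_eq (IsCMField.complexConj L) w H' hH' hw
    have hdet := congrArg Matrix.det hh
    rw [Matrix.det_transpose, ← RingHom.mapMatrix_apply, ← RingHom.map_det] at hdet
    rw [map_neg, hdet]
  have hdich := norm_dichotomy_of_not_norm_anyPlace L w hw hση hηN
  have hflip := exists_norm_mul_nonNorm_iff L w hw hηN hdich hdet0 hσdet
  have hy0 : yl ≠ 0 := fun h0 => hdet0 (by rw [← hyl, h0, map_zero])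
  rcases hilbertSymbol_eq_one_or_eq_neg_one yl
      (algebraMap ↥(maximalRealSubfield L) _ ((cmQuadraticGenerator L : 𝓞 ↥(maximalRealSubfield L)) : ↥(maximalRealSubfield L))) with h1 | h1
  · have hN : ∃ z : w.1.adicCompletion L, (galAdicCompletionMap (L := L) (IsCMField.complexConj L) hw) z * z = -(placeForm H' w.1).det := by
      rw [← hyl]; exact (hilbertSymbol_eq_one_iff_exists_norm_toPlace L v w hw hy0).1 h1
    rw [if_neg (fun h => hflip.1 h hN), h1]
  · have hN : ¬ ∃ z : w.1.adicCompletion L, (galAdicCompletionMap (L := L) (IsCMField.complexConj L) hw) z * z = -(placeForm H' w.1).det := fun hex => by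
      have h := (hilbertSymbol_eq_one_iff_exists_norm_toPlace L v w hw hy0).2 (by rw [hyl]; exact hex)
      rw [h] at h1
      exact absurd h1 (by norm_num)
    rw [if_pos (hflip.2 hN), h1, neg_neg]

end CM

end Summit.HodgeConjecture.HodgeConjecture.Cruxes.H413.F0P3cDyRamTypeTwoLiteralSignWild

end
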